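import Literature.NumberTheory.EllipticCurves.KummerImageIsotropyProofs
import HarnessLib

/-!
# `E[m] ≅ ℤ/mℤ × ℤ/mℤ` (Silverman, *AEC*, Cor. III.6.4(b)), proved

`Proofs`-style file (theorems only; no definition, no named fact, no instance).  The tree's named
fact `WeierstrassCurve.card_torsionPoints_eq_sq` (`GaloisAction.lean`, proved in
`GaloisActionProofs`) records Silverman's Cor. III.6.4(b) only through the cardinality
`#E[m] = m²`; the printed statement is the structure `E[m] ≅ ℤ/mℤ × ℤ/mℤ` ("If `m ≠ 0` in `K`,
`E[m] = ℤ/mℤ × ℤ/mℤ`"), which several files of the tree take as a hypothesis in the form of a frame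
`geomTorsion W m ≃+ (Fin 2 → ZMod m)`.  It is derived here from the generators produced in
`KummerImageIsotropyProofs` (`WeierstrassCurve.exists_addOrderOf_eq`: a point `P₀ ∈ E[m]` of order
`m`; `WeierstrassCurve.exists_isPrimitiveRoot_weilPairingFun`: `Q₀` with `e_m(P₀, Q₀)` a primitive
`m`-th root of unity, Cor. III.8.1.1): `(a, b) ↦ aP₀ + bQ₀` is an additive bijection
`ℤ/m × ℤ/m → E[m]` (injective by pairing with `Q₀` and `P₀`, bijective by counting).

* `WeierstrassCurve.nonempty_geomTorsion_addEquiv_prod` — `E[m] ≃+ ℤ/m × ℤ/m`;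
* `WeierstrassCurve.nonempty_geomTorsion_addEquiv_fin_two` — `E[m] ≃+ (Fin 2 → ℤ/m)`.

## References

* [SilvermanAEC2009] J. H. Silverman, *The Arithmetic of Elliptic Curves*, 2nd ed., GTM 106
  (2009), Cor. III.6.4(b); Cor. III.8.1.1.
-/

noncomputable section

open scoped Classical

universe u

namespace WeierstrassCurve

open Literature.NumberTheory.EllipticCurves

variable {F : Type u} [Field F] (W : WeierstrassCurve F) [W.IsElliptic] {m : ℕ}

/-- **`E[m] ≅ ℤ/mℤ × ℤ/mℤ`** for an elliptic curve `E = W` over a field `F` and `m` invertible in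
`F` (Silverman, *AEC*, Cor. III.6.4(b): "`E[m] = ℤ/mℤ × ℤ/mℤ`"): with `P₀ ∈ E[m]` of order `m` and
`Q₀` such that `e_m(P₀, Q₀)` is a primitive `m`-th root of unity, `(a, b) ↦ aP₀ + bQ₀` is an
isomorphism `ℤ/m × ℤ/m ≃ E[m]` — additive since `mP₀ = mQ₀ = O`, injective since
`e_m(aP₀ + bQ₀, Q₀) = e_m(P₀, Q₀)^a` and `e_m(P₀, aP₀ + bQ₀) = e_m(P₀, Q₀)^b`, onto by
`#E[m] = m²`. [cite: SilvermanAEC2009, Cor. III.6.4(b)] -/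
theorem nonempty_geomTorsion_addEquiv_prod (hm : (m : F) ≠ 0) :
    Nonempty (geomTorsion W m ≃+ ZMod m × ZMod m) := by
  have hm0 : m ≠ 0 := fun h ↦ hm (by rw [h, Nat.cast_zero])
  haveI : NeZero m := ⟨hm0⟩
  have hmZ : (m : ℤ) ≠ 0 := intCast_ne_zero_of_natCast_ne_zero hm
  haveI : Finite (geomTorsion W m) := finite_geomTorsion W hmZ
  letI : Fintype (geomTorsion W m) := Fintype.ofFinite _
  have mem := zsmul_coe_geomTorsion (W := W) (m := m)
  obtain ⟨P₀, hP₀⟩ := exists_addOrderOf_eq hm (W := W)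
  obtain ⟨Q₀, hprim⟩ := exists_isPrimitiveRoot_weilPairingFun hm hP₀
  have hmS : ∀ S : geomTorsion W m, m • S = 0 := fun S ↦ Subtype.ext (by
    rw [AddSubmonoidClass.coe_nsmul, ZeroMemClass.coe_zero, ← natCast_zsmul]
    exact mem S)
  -- the map `(a, b) ↦ aP₀ + bQ₀`
  let f : ZMod m × ZMod m →+ geomTorsion W m := AddMonoidHom.mk'
    (fun ab ↦ ab.1.val • P₀ + ab.2.val • Q₀) (by
      rintro ⟨a, b⟩ ⟨a', b'⟩
      change (a + a').val • P₀ + (b + b').val • Q₀ = (a.val • P₀ + b.val • Q₀) + (a'.val • P₀ + b'.val • Q₀)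
      rw [ZMod.val_add, ZMod.val_add, ← nsmul_eq_mod_nsmul _ (hmS P₀),
        ← nsmul_eq_mod_nsmul _ (hmS Q₀), add_nsmul, add_nsmul]
      abel)
  have hf : ∀ a b : ZMod m, f (a, b) = a.val • P₀ + b.val • Q₀ := fun _ _ ↦ rfl
  -- pairing `aP₀ + bQ₀` with `Q₀` and `P₀`
  have hvalQ : ∀ a b : ℕ, weilPairingFun hm (((a • P₀ + b • Q₀ : geomTorsion W m)) : W.geomPoints)
      (Q₀ : W.geomPoints) = weilPairingFun hm (P₀ : W.geomPoints) (Q₀ : W.geomPoints) ^ a := by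
    intro a b
    have ha : (m : ℤ) • (a • (P₀ : W.geomPoints)) = 0 := by
      rw [← natCast_zsmul, smul_comm, mem P₀, smul_zero]
    have hb : (m : ℤ) • (b • (Q₀ : W.geomPoints)) = 0 := by
      rw [← natCast_zsmul, smul_comm, mem Q₀, smul_zero]
    rw [AddSubmonoid.coe_add, AddSubmonoidClass.coe_nsmul, AddSubmonoidClass.coe_nsmul,
      weilPairingFun_add_left hm ha hb (mem Q₀), weilPairingFun_nsmul_left hm (mem P₀) (mem Q₀),
      weilPairingFun_nsmul_left hm (mem Q₀) (mem Q₀), weilPairingFun_self hm (mem Q₀), one_pow,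
      mul_one]
  have hvalP : ∀ a b : ℕ, weilPairingFun hm (P₀ : W.geomPoints)
      (((a • P₀ + b • Q₀ : geomTorsion W m)) : W.geomPoints) =
        weilPairingFun hm (P₀ : W.geomPoints) (Q₀ : W.geomPoints) ^ b := by
    intro a b
    have ha : (m : ℤ) • (a • (P₀ : W.geomPoints)) = 0 := by
      rw [← natCast_zsmul, smul_comm, mem P₀, smul_zero]
    have hb : (m : ℤ) • (b • (Q₀ : W.geomPoints)) = 0 := by
      rw [← natCast_zsmul, smul_comm, mem Q₀, smul_zero]
    rw [AddSubmonoid.coe_add, AddSubmonoidClass.coe_nsmul, AddSubmonoidClass.coe_nsmul,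
      weilPairingFun_add_right hm (mem P₀) ha hb, weilPairingFun_nsmul_right hm (mem P₀) (mem P₀),
      weilPairingFun_nsmul_right hm (mem P₀) (mem Q₀), weilPairingFun_self hm (mem P₀), one_pow,
      one_mul]
  have hinj : Function.Injective f := by
    rintro ⟨a, b⟩ ⟨a', b'⟩ h
    rw [hf, hf] at h
    have h1 := congrArg (fun S : geomTorsion W m ↦ weilPairingFun hm (S : W.geomPoints)
      (Q₀ : W.geomPoints)) h
    have h2 := congrArg (fun S : geomTorsion W m ↦ weilPairingFun hm (P₀ : W.geomPoints)
      (S : W.geomPoints)) h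
    simp only [hvalQ, hvalP] at h1 h2
    have ea : a.val = a'.val := hprim.pow_inj (ZMod.val_lt a) (ZMod.val_lt a') h1
    have eb : b.val = b'.val := hprim.pow_inj (ZMod.val_lt b) (ZMod.val_lt b') h2
    exact Prod.ext (ZMod.val_injective m ea) (ZMod.val_injective m eb)
  have hcard : Fintype.card (ZMod m × ZMod m) = Fintype.card (geomTorsion W m) := by
    rw [Fintype.card_prod, ZMod.card, ← Nat.card_eq_fintype_card,
      show Nat.card (geomTorsion W m) = m ^ 2 from
        card_torsionPoints_eq_sq_holds W (AlgebraicClosure F) (natCast_algebraicClosure_ne_zero' hm),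
      pow_two]
  have hbij : Function.Bijective f := (Fintype.bijective_iff_injective_and_card f).mpr ⟨hinj, hcard⟩
  exact ⟨(AddEquiv.ofBijective f hbij).symm⟩

/-- **`E[m] ≅ (ℤ/mℤ)²` as a frame `E[m] ≃+ (Fin 2 → ℤ/m)`** (the form in which the tree's files on
mod-`m` Galois representations take Silverman's Cor. III.6.4(b) as a hypothesis).
[cite: SilvermanAEC2009, Cor. III.6.4(b)] -/
theorem nonempty_geomTorsion_addEquiv_fin_two (hm : (m : F) ≠ 0) :
    Nonempty (geomTorsion W m ≃+ (Fin 2 → ZMod m)) := by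
  obtain ⟨e⟩ := nonempty_geomTorsion_addEquiv_prod W hm
  exact ⟨e.trans (LinearEquiv.piFinTwo ℤ (fun _ : Fin 2 ↦ ZMod m)).toAddEquiv.symm⟩

end WeierstrassCurve

end
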